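import Mathlib
import HarnessLib
import Summits.ValiantsHypothesis.ValiantsHypothesis.Theorems.SymmetryDialBentGame

/-!
# SymmetryDial — (B) «bent ⇒ C³-blind», conclusion: invariant positions are partial isomorphisms

Route `SymmetryDial` (workshop `decomp-valiant`, lens 1, gen 8), item 23711 (P′ = `AffinePebblePairs`);
sequel of `Theorems/SymmetryDialBentGame.lean` (Duplicator's invariant `Inv` and her move).  Here:
every invariant position is a partial isomorphism of the affine matrix structures `𝔄(M_f) ⇀ 𝔄(M_g)`
(`isPartialIso_of_inv`) — sorts, `mat` (two pebbled points: `f(a+b) = g(a'+b')`), `inc` (a pebbled dual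
and two pebbled points), and `aff`, which with only three pebble pairs is inspected on `4`-tuples with a
repeated pair and then reduces to an equality of the two remaining coordinates — and the theorem
**`bentCThreeBlind : BentCThreeBlind`**: bent `f, g` with `wt f = wt g`, `f 0 = g 0` have
`C³`-equivalent affine matrix structures (`AffinePebbleEquiv 3 d (grpMat f) (grpMat g)`).  With
`SymmetryDialWalsh.wt_eq_of_pebbleEquiv_three` the weight hypothesis is also necessary.  This settles the
`k′ = 3` column of the census for the bent habitat of P′ by a theorem (LADDER-Valiant rung 0: instrument
calibration; nothing here bears on VP ≠ VNP).
-/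

namespace Summit.ValiantsHypothesis.ValiantsHypothesis.Theorems.SymmetryDialBentCThree

open Finset
open Literature.ModelTheory.FiniteModelTheory
open SymmetryDialAffinePebble (V AffRel Laff pair RelHolds affStr AffinePebbleEquiv)
open SymmetryDialAffinePebbleThree (grpMat)
open SymmetryDialWalsh (sgn walsh wt)
open SymmetryDialBent (IsBent BentCThreeBlind)
open SymmetryDialBentGame (U Pos Inv positions strategy)

variable {d : ℕ}

/-! ### 1. The affine relation on tuples with a repetition -/

/-- `a + b + c = e ↔ a + b + c + e = 0` in characteristic `2`. -/
theorem aff_iff_sum4 (a b c e : V d) : a + b + c = e ↔ a + b + c + e = 0 := by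
  constructor
  · intro h; rw [h, SymmetryDialPerCongruence.two_nsmul_eq_zero]
  · intro h
    have := (SymmetryDialWalsh.add_eq_zero_iff (a + b + c) e).1 h
    exact this.symm

/-- The symmetric `4`-sum of a tuple. -/
def sum4 (z : Fin 4 → V d) : V d := z 0 + z 1 + z 2 + z 3

/-- Off two distinct indices of `Fin 4` there is a complementary pair. -/
theorem exists_cover {j j' : Fin 4} (hjj : j ≠ j') :
    ∃ m n : Fin 4, ({j, j', m, n} : Finset (Fin 4)) = univ := by
  revert hjj; revert j j'; decide

/-- With a repetition `w j = w j'` and `{j, j', m, n} = Fin 4`: `Σ w = 0 ↔ w m = w n`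
(`x + x + y + u = 0 ↔ y = u` in characteristic `2`). -/
theorem sum4_eq_zero_iff (w : Fin 4 → V d) {j j' m n : Fin 4} (hw : w j = w j')
    (hcov : ({j, j', m, n} : Finset (Fin 4)) = univ) : sum4 w = 0 ↔ w m = w n := by
  have hsurj : Function.Surjective (![j, j', m, n] : Fin 4 → Fin 4) := by
    intro t
    have ht : t ∈ ({j, j', m, n} : Finset (Fin 4)) := by rw [hcov]; exact mem_univ t
    simp only [mem_insert, mem_singleton] at ht
    rcases ht with h | h | h | h
    · exact ⟨0, by simp [h]⟩
    · exact ⟨1, by simp [h]⟩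
    · exact ⟨2, by simp [h]⟩
    · exact ⟨3, by simp [h]⟩
  have hbij : Function.Bijective (![j, j', m, n] : Fin 4 → Fin 4) :=
    ⟨Finite.injective_iff_surjective.2 hsurj, hsurj⟩
  have hs : sum4 w = w j + w j' + w m + w n := by
    have h1 : sum4 w = ∑ t, w t := by simp [sum4, Fin.sum_univ_four, add_assoc]
    rw [h1, ← hbij.sum_comp w, Fin.sum_univ_four]
    simp
  rw [hs, hw, SymmetryDialPerCongruence.two_nsmul_eq_zero, zero_add, SymmetryDialWalsh.add_eq_zero_iff]
  exact ⟨fun h => h.symm, fun h => h.symm⟩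

/-- Transfer principle: two tuples with the same repetition `j, j'` and the same equality pattern satisfy
`Σ = 0` simultaneously. -/
theorem sum4_transfer {z z' : Fin 4 → V d} {j j' : Fin 4} (hjj : j ≠ j') (hz : z j = z j')
    (hz' : z' j = z' j') (heq : ∀ m n, z m = z n ↔ z' m = z' n) : sum4 z = 0 ↔ sum4 z' = 0 := by
  obtain ⟨m, n, hcov⟩ := exists_cover hjj
  rw [sum4_eq_zero_iff z hz hcov, sum4_eq_zero_iff z' hz' hcov]
  exact heq m n

/-! ### 2. Invariant positions are partial isomorphisms -/

section
variable {f g fd gd : V d → Bool}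

/-- **Every invariant position is a partial isomorphism `𝔄(M_f) ⇀ 𝔄(M_g)`.** -/
theorem isPartialIso_of_inv {p : Pos d} (hp : Inv f g fd gd p) :
    @PebblePosition.IsPartialIso 3 (U d) (U d) Laff (affStr (grpMat f)) (affStr (grpMat g)) p := by
  classical
  refine ⟨fun a a' b b' ⟨i, hi⟩ ⟨j, hj⟩ => hp.eq i j _ _ _ _ hi hj, ?_⟩
  intro r R xs ys hpeb
  have hsort : ∀ j, (∃ a b : V d, xs j = .inl a ∧ ys j = .inl b) ∨
      (∃ ξ η : V d, xs j = .inr ξ ∧ ys j = .inr η) := fun j => by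
    obtain ⟨i, hi⟩ := hpeb j; exact hp.sort i _ _ hi
  have ptL : ∀ j, (∃ a, xs j = Sum.inl a) ↔ ∃ b, ys j = Sum.inl b := fun j => by
    rcases hsort j with ⟨a, b, ha, hb⟩ | ⟨ξ, η, hξ, hη⟩
    · exact ⟨fun _ => ⟨b, hb⟩, fun _ => ⟨a, ha⟩⟩
    · constructor
      · rintro ⟨a, ha⟩; rw [hξ] at ha; cases ha
      · rintro ⟨b, hb⟩; rw [hη] at hb; cases hb
  have dlL : ∀ j, (∃ ξ, xs j = Sum.inr ξ) ↔ ∃ η, ys j = Sum.inr η := fun j => by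
    rcases hsort j with ⟨a, b, ha, hb⟩ | ⟨ξ, η, hξ, hη⟩
    · constructor
      · rintro ⟨ξ, hξ⟩; rw [ha] at hξ; cases hξ
      · rintro ⟨η, hη⟩; rw [hb] at hη; cases hη
    · exact ⟨fun _ => ⟨η, hη⟩, fun _ => ⟨ξ, hξ⟩⟩
  cases R with
  | pt => exact ptL 0
  | dl => exact dlL 0
  | mat =>
    show (∃ a b : V d, xs 0 = .inl a ∧ xs 1 = .inl b ∧ grpMat f (a, b) = true) ↔
      (∃ a b : V d, ys 0 = .inl a ∧ ys 1 = .inl b ∧ grpMat g (a, b) = true)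
    rcases hsort 0 with ⟨a₀, b₀, ha₀, hb₀⟩ | ⟨ξ₀, η₀, hξ₀, hη₀⟩
    · rcases hsort 1 with ⟨a₁, b₁, ha₁, hb₁⟩ | ⟨ξ₁, η₁, hξ₁, hη₁⟩
      · obtain ⟨i₀, hi₀⟩ := hpeb 0
        obtain ⟨i₁, hi₁⟩ := hpeb 1
        rw [ha₀, hb₀] at hi₀; rw [ha₁, hb₁] at hi₁
        have hm : f (a₀ + a₁) = g (b₀ + b₁) := hp.mat i₀ i₁ a₀ b₀ a₁ b₁ hi₀ hi₁
        constructor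
        · rintro ⟨a, b, ha, hb, hab⟩
          rw [ha₀] at ha; rw [ha₁] at hb
          cases Sum.inl_injective ha; cases Sum.inl_injective hb
          refine ⟨b₀, b₁, hb₀, hb₁, ?_⟩
          simp only [grpMat] at hab ⊢; rw [← hm]; exact hab
        · rintro ⟨a, b, ha, hb, hab⟩
          rw [hb₀] at ha; rw [hb₁] at hb
          cases Sum.inl_injective ha; cases Sum.inl_injective hb
          refine ⟨a₀, a₁, ha₀, ha₁, ?_⟩
          simp only [grpMat] at hab ⊢; rw [hm]; exact hab
      · constructor
        · rintro ⟨a, b, -, hb, -⟩; rw [hξ₁] at hb; cases hb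
        · rintro ⟨a, b, -, hb, -⟩; rw [hη₁] at hb; cases hb
    · constructor
      · rintro ⟨a, b, ha, -, -⟩; rw [hξ₀] at ha; cases ha
      · rintro ⟨a, b, ha, -, -⟩; rw [hη₀] at ha; cases ha
  | inc =>
    show (∃ (ξ a b : V d), xs 0 = .inr ξ ∧ xs 1 = .inl a ∧ xs 2 = .inl b ∧ pair ξ (a + b) = 0) ↔
      (∃ (ξ a b : V d), ys 0 = .inr ξ ∧ ys 1 = .inl a ∧ ys 2 = .inl b ∧ pair ξ (a + b) = 0)
    rcases hsort 0 with ⟨a₀, b₀, ha₀, hb₀⟩ | ⟨ξ₀, η₀, hξ₀, hη₀⟩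
    · constructor
      · rintro ⟨ξ, a, b, h0, -, -, -⟩; rw [ha₀] at h0; cases h0
      · rintro ⟨ξ, a, b, h0, -, -, -⟩; rw [hb₀] at h0; cases h0
    rcases hsort 1 with ⟨a₁, b₁, ha₁, hb₁⟩ | ⟨ξ₁, η₁, hξ₁, hη₁⟩
    swap
    · constructor
      · rintro ⟨ξ, a, b, -, h1, -, -⟩; rw [hξ₁] at h1; cases h1
      · rintro ⟨ξ, a, b, -, h1, -, -⟩; rw [hη₁] at h1; cases h1
    rcases hsort 2 with ⟨a₂, b₂, ha₂, hb₂⟩ | ⟨ξ₂, η₂, hξ₂, hη₂⟩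
    swap
    · constructor
      · rintro ⟨ξ, a, b, -, -, h2, -⟩; rw [hξ₂] at h2; cases h2
      · rintro ⟨ξ, a, b, -, -, h2, -⟩; rw [hη₂] at h2; cases h2
    obtain ⟨i₀, hi₀⟩ := hpeb 0
    obtain ⟨i₁, hi₁⟩ := hpeb 1
    obtain ⟨i₂, hi₂⟩ := hpeb 2
    rw [hξ₀, hη₀] at hi₀; rw [ha₁, hb₁] at hi₁; rw [ha₂, hb₂] at hi₂
    have hinc := hp.inc i₀ i₁ i₂ ξ₀ η₀ a₁ b₁ a₂ b₂ hi₀ hi₁ hi₂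
    constructor
    · rintro ⟨ξ, a, b, h0, h1, h2, h⟩
      rw [hξ₀] at h0; rw [ha₁] at h1; rw [ha₂] at h2
      cases Sum.inr_injective h0; cases Sum.inl_injective h1; cases Sum.inl_injective h2
      exact ⟨η₀, b₁, b₂, hη₀, hb₁, hb₂, hinc.1 h⟩
    · rintro ⟨ξ, a, b, h0, h1, h2, h⟩
      rw [hη₀] at h0; rw [hb₁] at h1; rw [hb₂] at h2
      cases Sum.inr_injective h0; cases Sum.inl_injective h1; cases Sum.inl_injective h2
      exact ⟨ξ₀, a₁, a₂, hξ₀, ha₁, ha₂, hinc.2 h⟩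
  | aff =>
    show (∃ a b c e : V d, xs 0 = .inl a ∧ xs 1 = .inl b ∧ xs 2 = .inl c ∧ xs 3 = .inl e ∧
        a + b + c = e) ↔
      (∃ a b c e : V d, ys 0 = .inl a ∧ ys 1 = .inl b ∧ ys 2 = .inl c ∧ ys 3 = .inl e ∧
        a + b + c = e)
    by_cases hall : ∀ j, ∃ a, xs j = Sum.inl a
    swap
    · push Not at hall
      obtain ⟨j, hj⟩ := hall
      have hj' : ∀ b, ys j ≠ Sum.inl b := by
        intro b hb; exact absurd ((ptL j).2 ⟨b, hb⟩) (by simpa using hj)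
      constructor
      · rintro ⟨a, b, c, e, h0, h1, h2, h3, -⟩
        fin_cases j <;> [exact (hj a h0).elim; exact (hj b h1).elim; exact (hj c h2).elim;
          exact (hj e h3).elim]
      · rintro ⟨a, b, c, e, h0, h1, h2, h3, -⟩
        fin_cases j <;> [exact (hj' a h0).elim; exact (hj' b h1).elim; exact (hj' c h2).elim;
          exact (hj' e h3).elim]
    choose x hx using hall
    have hall' : ∀ j, ∃ b, ys j = Sum.inl b := fun j => (ptL j).1 ⟨x j, hx j⟩
    choose y hy using hall'
    -- the pebble index of each coordinate; two coordinates share one (four coordinates, three pairs)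
    have hidx : ∀ j, ∃ i, p i = some (Sum.inl (x j), Sum.inl (y j)) := fun j => by
      obtain ⟨i, hi⟩ := hpeb j; rw [hx j, hy j] at hi; exact ⟨i, hi⟩
    choose ι hι using hidx
    obtain ⟨j, j', hjj, hιeq⟩ := Fintype.exists_ne_map_eq_of_card_lt ι (by simp)
    have hxeq : x j = x j' := by
      have h1 := hι j; have h2 := hι j'; rw [hιeq] at h1; rw [h1] at h2
      exact Sum.inl_injective (Prod.mk.inj (Option.some_injective _ h2)).1
    have hyeq : y j = y j' := by
      have h1 := hι j; have h2 := hι j'; rw [hιeq] at h1; rw [h1] at h2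
      exact Sum.inl_injective (Prod.mk.inj (Option.some_injective _ h2)).2
    have heq : ∀ m n, x m = x n ↔ y m = y n := fun m n => by
      have := hp.eq (ι m) (ι n) _ _ _ _ (hι m) (hι n)
      simp only [Sum.inl.injEq] at this
      exact this
    have key := sum4_transfer (z := x) (z' := y) hjj hxeq hyeq heq
    simp only [sum4] at key
    constructor
    · rintro ⟨a, b, c, e, h0, h1, h2, h3, habc⟩
      rw [hx 0] at h0; rw [hx 1] at h1; rw [hx 2] at h2; rw [hx 3] at h3
      cases Sum.inl_injective h0; cases Sum.inl_injective h1
      cases Sum.inl_injective h2; cases Sum.inl_injective h3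
      refine ⟨y 0, y 1, y 2, y 3, hy 0, hy 1, hy 2, hy 3, ?_⟩
      rw [aff_iff_sum4] at habc ⊢
      exact key.1 habc
    · rintro ⟨a, b, c, e, h0, h1, h2, h3, habc⟩
      rw [hy 0] at h0; rw [hy 1] at h1; rw [hy 2] at h2; rw [hy 3] at h3
      cases Sum.inl_injective h0; cases Sum.inl_injective h1
      cases Sum.inl_injective h2; cases Sum.inl_injective h3
      refine ⟨x 0, x 1, x 2, x 3, hx 0, hx 1, hx 2, hx 3, ?_⟩
      rw [aff_iff_sum4] at habc ⊢
      exact key.2 habc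

end

/-! ### 3. The theorem -/

/-- **(B) «bent ⇒ C³-blind»**: bent `f, g : 𝔽₂^d → 𝔽₂` with `wt f = wt g` and `f 0 = g 0` have
`C³`-equivalent affine matrix structures `𝔄(M_f) ≡_{C³} 𝔄(M_g)`. -/
theorem bentCThreeBlind : BentCThreeBlind := by
  intro d f g hf hg hwt h0
  obtain ⟨fd, hfd⟩ := hf.exists_dual
  obtain ⟨gd, hgd⟩ := hg.exists_dual
  exact ⟨strategy hf hg hfd hgd hwt h0, fun _ hp => isPartialIso_of_inv hp⟩

/-- The typed target decl of `SymmetryDialBent` holds. -/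
theorem bentCThreeBlind_holds : SymmetryDialBent.BentCThreeBlind := bentCThreeBlind

end Summit.ValiantsHypothesis.ValiantsHypothesis.Theorems.SymmetryDialBentCThree
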